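import Mathlib
import HarnessLib
import HarnessLib.Audit
import Summits.ValiantsHypothesis.Statement
import Literature.Computability.AlgebraicComplexity.DeterminantalComplexity
import Literature.Computability.AlgebraicComplexity.PermanentVsDeterminant
import Literature.Computability.AlgebraicComplexity.EquivariantDC
import Literature.Computability.AlgebraicComplexity.LandsbergRessayre

/-!
Route: GrenetRigidity

CLOSED (refuted) 2026-08-15T16:23:10Z by planner-rbadge-ValiantsHypothesis-GrenetRigidi-0cc5e3a7-g2-0 — reason: refuted:stmt-ValiantsHypothesis-3735 (OptimalUnique) by Summit.ValiantsHypothesis.Theorems.GrenetRigidityOptimalUnique_refuted — note: refuted:OptimalUnique — SUBSTANTIVE, no repair inside this line. Witness (Theorems/GrenetRigidityOptimalUniqueRefutation.lean @7357d070): Grenet's 7×7 A and its null-transvection twist B = A·(1+D) (D linear, A_lin·D = 0, det(1+D) = 1) are both affine reps of per_3; the X(0,0)-coefficient matrix has . The file is kept as the record of this route; refuted decls are indexed as negative knowledge (`ledger negatives`).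

# Route GrenetRigidity — Grenet is rigid — window-indecomposability, uniqueness and Laplace gluing
force dc(per_{n+1}) ≥ 2·dc(per_n)+1

It suffices to show X: the affine determinantal complexity of the permanent over ℂ grows at least
exponentially,
∃ c > 1 ∃ n₀ ∀ n ≥ n₀, c^n ≤ dc(per_n) (card grenet-stability-bootstrap, spine and only card). The
plan for X is the
stability-method template exact → unique → bootstrap run on Grenet's size-(2^n − 1) representation:
WindowStability (no
indecomposable representation of per_n has size in the doubling window (dc, 2·dc]), OptimalUnique
(optimal representations
form ONE orbit of GL_m × GL_m × G_per × transpose), LaplaceBootstrap (these two force dc(per_{n+1})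
≥ 2·dc(per_n) + 1 by
gluing the (n+1)² restrictions "row i ↦ column j" of an optimal representation of per_{n+1}), and
the decisive small case
DcPerFour (dc(per_4) = 15). Doubling from n = 3 gives dc(per_n) ≥ 2^n − 1, i.e. Grenet is optimal
(Conjecture G), far more than X.
Lean: `∃ c : ℝ, 1 < c ∧ ∃ n₀ : ℕ, ∀ n ≥ n₀, c ^ n ≤
(Literature.Computability.AlgebraicComplexity.determinantalComplexity
(Literature.Computability.AlgebraicComplexity.perPoly (Fin n) ℂ) : ℝ)`

## Assembly
X → ValiantsHypothesis is standard and rests on facts PROVED in tree: if VP ℂ = VNP ℂ then perFamily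
ℂ ∈ VP ℂ
(perFamily_mem_VNP_holds), hence IsVPFamily (perPoly (Fin n) ℂ) (mem_VP_ofFintype_iff_holds), hence
dc(per_n) is
quasi-polynomially bounded (isQPBounded_determinantalComplexity_of_isVPFamily_holds: VP ⊆ VQP =
qp-projections of DET,
Burgisser2000 Prop 2.30 / BCS97 Cor (21.40)), contradicting c^n ≤ dc(per_n) because 2^((log₂ n +
a)^a) = o(c^n). The cruxes
compose to X by DoublingGlue (pure induction). So the ledger chain is WindowStability →
OptimalUnique → LaplaceBootstrap →
DcPerExponential → ValiantsHypothesis; DcPerFour is the decisive test value, implied by the three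
cruxes at n = 3.

Rationale: WHY THIS LINE. The lower bound is to come from the SHAPE of the extremiser, not from a complexity
measure: per_n is irreducible, so a
representation that block-triangularises over constants splits as (smaller representation) ⊕
(unimodular junk), and "every
representation in the window (dc, 2dc] is decomposable" plus "optimal ones are unique" is exactly
the stability input that
lets Laplace restriction per_{n+1}|_{row i ↦ col j} = per_n bootstrap n → n+1
(Simonovits/Keevash–Mubayi stability method,
Keevash2011 §5, imported from extremal combinatorics). It is the commutative shadow of Nisan's layer
count (Nisan1991: the
homogeneous non-commutative ABP size of per_m is exactly 2^m − 1 = Σ_s C(m,s), Grenet's number;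
layers there = minors here).
Evidence: dc(per_3) = 7 = 2^3 − 1 (AlperBogartVelasco2017 Cor 1.4); in the binary model all 463
size-7 matrices with det = per_3
are ONE orbit, Grenet's (HuttenhainIkenmeyer2016 Prop 9, arXiv:1410.8202 §4); Grenet's expression is
optimal and unique among
Γ^E-equivariant ones (LandsbergRessayre2017 Thm 2.8, Landsberg2017 Thm 7.4.1.1, lower bound PROVED
in tree as
lr_left_equivariant_lower_holds). Unlike route DetQP's crux DetqpSymmetrization and the cards
rigidity-implies-grenet /
rigid-minimal-detreps-inherit-symmetry, no symmetry is imposed or inherited and LR17's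
representation theory is not the
engine: uniqueness + window-indecomposability feed an INDUCTION ON n. Negatives index empty at
filing.

RANKED CRUXES. #0 DcPerExponential (target) — X — there are c > 1 and n₀ with c^n ≤ dc(per_n) over ℂ
for all n ≥ n₀ (output of any bootstrapped recursion dc(per_{n+1}) ≥ (1+δ)·dc(per_n), in particular
of doubling). (why it might fail: X is far stronger than VH: dc(per_n) = 2^{o(n)} (e.g. n^{O(log
n)}, compatible with VP ≠ VNP) refutes X while nothing beyond n²/2 ≤ dc(per_n) ≤ 2^n − 1 is known.)
[Grenet2011, MignonRessayre2004, AlperBogartVelasco2017, LandsbergRessayre2017, Landsberg2017]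
#2 WindowStability (crux) — for every n ≥ 3 and every m with dc(per_n) < m ≤ 2·dc(per_n), every m×m
affine determinantal representation A of per_n over ℂ is DECOMPOSABLE: there are constant P, Q ∈
GL_m(ℂ) and 0 < r < m such that P·A·Q is block upper triangular with diagonal blocks of sizes r, m −
r (so, per_n being irreducible, A contains a smaller representation plus unimodular junk; iterating,
an optimal one). Card Crux1, sharpened from the (1+ε)-window to the doubling window the bootstrap
actually consumes. [difficulty: XL] (why it might fail: Glynn/product-rank-4 depth-3 representations
(size (n−1)·2^{n−1}+1: 9 at n=3, 25 at n=4) and bordered matrices [[G,e_p],[e_qᵀ,1]] with a cofactor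
of Grenet's G vanishing by cancellation lie in the window; ONE indecomposable such matrix at some n
≥ 3 refutes it as stated (repair: n ≥ n₀).) [Glynn2010, IltenTeitler2016, HuttenhainIkenmeyer2016,
Grenet2011, Keevash2011]
#3 OptimalUnique (crux) — for every n ≥ 3, any two affine determinantal representations A, B of
per_n over ℂ of optimal size m = dc(per_n) are equivalent: B = P·A(γ·x)·Q or B = P·A(γ·x)ᵀ·Q with P,
Q ∈ GL_m(ℂ) constant and γ in the realised symmetry group of per_n (monomial row/column
substitutions and x ↦ xᵀ, `permSymmetrySubst`). With dc(per_n) = 2^n − 1 this says: optimal =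
Grenet. Card "uniqueness of the optimal representation up to symmetry". [difficulty: XL] (why it
might fail: determinantal representations are generically NOT unique (72 inequivalent size-3
representations of a smooth cubic surface); over ℂ even n = 3 is open (HI16 Prop 9 is binary-only):
a positive-dimensional family of inequivalent size-7 representations of per_3 refutes it.)
[HuttenhainIkenmeyer2016, arXiv:1410.8202, LandsbergRessayre2017, Landsberg2017,
AlperBogartVelasco2017]
#4 LaplaceBootstrap (crux) — the bootstrapping (gluing) lemma — WindowStability and OptimalUnique
imply dc(per_{n+1}) ≥ 2·dc(per_n) + 1 for every n ≥ 3: if dc(per_{n+1}) ≤ 2·dc(per_n), the (n+1)²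
restrictions x_{ij} = 1, rest of row i and column j = 0 of an optimal representation of per_{n+1}
are representations of per_n in the window, each contains an invariant optimal core (a copy of the
unique optimal representation), and compatibility of these cores along per_{n+1} = Σ_j x_{n+1,j}
per_n(minor) forces ≥ 2·dc(per_n) + 1 dimensions. Card Crux2. [deps: WindowStability, OptimalUnique]
[difficulty: L] (why it might fail: the (n+1)² cores overlap (in Grenet_{n+1} two complementary
Grenet_n cores share 2^{n−1} coordinates), so forcing total dimension 2·dc+1 is a non-abelian gluing
problem without precedent; and dc(per_4) ≤ 14 with both hypotheses true would falsify it at n = 3.)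
[Nisan1991, Grenet2011, Keevash2011, arXiv:1410.8202, LandsbergRessayre2017]
#5 DcPerFour (crux) — dc(per_4) = 15 over ℂ — Grenet's 15×15 representation of the 4×4 permanent is
optimal (Conjecture G at n = 4; the first value the doubling 2·7+1 predicts; certified computation /
new lower-bound technique). Card Crux3. [difficulty: XL] (why it might fail: only 9 ≤ dc(per_4) ≤ 15
is known (ABV17 Cor 1.4; Grenet) and bdc(per_4) was out of reach of HI16's cluster enumeration; a
size-14 affine representation over ℂ (cheap to hunt numerically) refutes it and Conjecture G, though
not VH.) [AlperBogartVelasco2017, arXiv:1505.02205, HuttenhainIkenmeyer2016, Grenet2011]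
#9 OptimalUniqueThree (support) — Step 0 over ℂ (special case n = 3 of OptimalUnique at the known
value dc(per_3) = 7): any two 7×7 affine determinantal representations of per_3 over ℂ are
equivalent under GL_7 × GL_7 × G_per × transpose — the complex (continuous-family-excluding) version
of HI16 Prop 9; infinitesimal rigidity of Grenet's 7×7 (490 unknowns, 11440 equations) is its
linearisation. [difficulty: L] [HuttenhainIkenmeyer2016, arXiv:1410.8202, AlperBogartVelasco2017]
#9 DoublingGlue (support) — the layer-1 glue: WindowStability, OptimalUnique and LaplaceBootstrap
give doubling for all n ≥ 3, hence dc(per_n) ≥ 2^{n−3}·(dc(per_3)+1) − 1 ≥ (3/2)^n eventually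
(dc(per_3) ≥ 1 from totalDegree ≤ dc, proved in tree), i.e. X. [difficulty: provable-now]
[MignonRessayre2004, Grenet2011]

TWO-LAYER PLAN. Foreseen glued splits (k ≤ 3, filed only when a crux closes or stalls with a
census): LaplaceBootstrap ⇐ CoreExtraction (a window
representation has an invariant optimal core pair (V, W), from WindowStability by descending
induction on size) → CoreSpan (the
cores of the (n+1)² restrictions of one matrix span ≥ 2·dc(per_n)+1 dimensions, using the explicit
restriction pattern of the
unique optimal representation) → LaplaceBootstrap. WindowStability ⇐ slack-one case (bordered
matrices, "no cofactor of an optimal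
representation vanishes by cancellation") → ABP/depth-3-derived representations → general.
OptimalUnique ⇐ infinitesimal rigidity
of Grenet (T_A R = T_A(orbit)) → finitely many orbits → one orbit (OptimalUniqueThree is the n = 3
instance).

KILL CRITERIA. dc(per_n) = 2^{o(n)} proved anywhere refutes X: close `refuted:DcPerExponential` (VH
survives on other routes). A size-≤14
representation of per_4 refutes DcPerFour and Conjecture G: the route survives only if
WindowStability/OptimalUnique visibly fail
at n = 3 in a way absent for large n — otherwise LaplaceBootstrap is dead and the route closes
`refuted:LaplaceBootstrap`. An
indecomposable window representation or a continuous family of optimal ones at a single small n ⇒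
ONE restate of
WindowStability/OptimalUnique to n ≥ n₀ (eventual form); an infinite family of such n ⇒ close.
DetQP's DetqpThesis or any
exponential dc bound proved elsewhere moots the route (superseded).

NOT DECOMPOSED YET. Per-n predicates (WindowStabilityAt n, OptimalUniqueAt n) and the eventual (n ≥
n₀) forms — kept inline until the definition
requests land; the restriction calculus (a restriction of a representation of per_{n+1} is one of
per_n: HasDetRepr.of_isProjection,
proved) lives inside LaplaceBootstrap's proof; the analytic step exponential ⇒ ¬IsQPBounded lives
inside Assembly; the certificate
format for DcPerFour (numerical algebraic geometry vs. structure theory à la ABV17) is the prover's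
choice; no items below the cruxes.

CHEAPEST FALSIFIER. (a) Cofactors of Grenet's matrix: list the identically-zero cofactors of the 7×7
(n=3) and 15×15 (n=4) Grenet matrices and test
each for a Frobenius–Kőnig zero pattern; a cofactor vanishing by CANCELLATION gives a bordered
size-2^n matrix [[G,e_p],[e_qᵀ,1]]
with det = per_n that is the prime indecomposable suspect against WindowStability (script written:
folder grenet_cof/main.py;
the kit compute socket was absent at filing, so NOT run). (b) Linear algebra on Glynn's 9×9
representation of per_3: does it
block-triangularise down to size 7? (by hand: the first step 9 → 8 works — the three Hadamard
vectors Σ_δ δ_j e_{w_δ} of the last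
layer span an (8,8) invariant pair.) (c) Numerical hunt (Newton/alternating least squares on
11440-type coefficient equations) for a
14×14 affine representation of per_4: one hit kills DcPerFour and Conjecture G.

NUMBERS. dc(per_1) = 1, dc(per_2) = 2 (HuttenhainIkenmeyer2016 p.3; tree
OccurrenceObstructionsFresh), dc(per_3) = 7 (AlperBogartVelasco2017
Cor 1.4; bdc(per_3) = 7, HI16 Thm 3), 9 ≤ dc(per_4) ≤ 15 (ABV17 Cor 1.4, Grenet2011), n²/2 ≤
dc(per_n) ≤ 2^n − 1 for n ≥ 3
(MignonRessayre2004 Thm 1.1, Grenet2011 Thm 1; both in tree). Competing formulas: Glynn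
(n−1)·2^{n−1}+1 (9, 25, 65: inside the
doubling window (2^n−1, 2^{n+1}−2] only for n ≤ 4), Ryser ≈ n·2^n. Symmetric values:
left-equivariant optimum 2^n − 1, full edc
C(2n,n) − 1 (LandsbergRessayre2017 Thms 2.8, 2.1). Homogeneous nc-ABP size of per_n: exactly 2^n − 1
(Nisan1991). Binary uniqueness
at n = 3: 463 matrices, one orbit (HI16 Prop 9). Rigidity system at n = 3: 490 unknowns, 11440
equations. Items at open: 8 (4 cruxes).

DEFINITION REQUESTS. To file after open (topic
Summits/ValiantsHypothesis/ValiantsHypothesis/Theorems): `IsBlockDecomposable` (an affine square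
matrix
over MvPolynomial σ k is block-upper-triangularisable by a CONSTANT two-sided change of bases, with
the API "decomposable
representation of an irreducible f contains a smaller representation") and `DetReprEquivalent`
(orbit equivalence of affine
determinantal representations under GL_m × GL_m × a subgroup of GL σ k × transpose), so that
WindowStability/OptimalUnique get
per-n named forms and restatements are one line. No cite facts needed: every fact used by the
Assembly is proved in tree.

Novelty: Searches (2026-08-15): `lit search --source zbmath "determinantal complexity permanent"` (14: LR17,
MR04, IL17, HI16, ABV-adjacent,
Qiao–Sun–Yu 2013, Boralevi et al. 2017 — none on uniqueness/induction); `lit search --source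
crossref "binary determinantal complexity
permanent"` (HI16, Kumar–Volk 2022, Chillara–Mukhopadhyay 2019); `lit search --source crossref
"indecomposable determinantal
representation … permanent"` (0 relevant); `lit vsearch "every optimal determinantal representation
of the permanent is equivalent
to Grenet's"` (Landsberg2017 pp.177,193-4,250-2; BCS97); `lit galaxy search "determinantal
complexity of the permanent" --star pdf`
(3: Rowlands thesis, Ban notes, ECCC TR22-099) and `… "determinantal representation of the
permanent" --star all` (0);
`lit frontier ValiantsHypothesis --since 2021` (30 rows; Bedi–Suagee 2026 degree-2 bound, nothing on
rigidity); local FTS daemon and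
OpenAlex/arXiv were unavailable (connection reset / HTTP 429). Read: HI16 §4 pp.3,8; LR17 pp.2,5,6;
ABV17 p.3; Landsberg2017 §6.6.3, §7.4.1.
Nearest prior art found: LandsbergRessayre2017 Question 2.2 / Cor 2.3 and Landsberg2017 Thm 7.4.1.1
(Grenet optimal AND unique among
Γ^E-equivariant expressions; "optimal ⇒ symmetric" as a potential path); HuttenhainIkenmeyer2016
Prop 9 (all 463 binary 7×7
representations of per_3 are one orbit); Nisan1991 (2^m − 1 via restriction-to-layer dimension
count, non-commutative).
Delta: symmetry is neither imposed nor inherited — uniqueness of optimal re  [refs: Landsberg2017, LandsbergRessayre2017, HuttenhainIkenmeyer2016, Nisan1991]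

Barriers (technique_class: stability-method, rigidity, certified-computation): - technique_class: stability-method, rigidity, certified-computation
- Literature.Barriers.ValiantsHypothesis.AlgebraicNaturalProofs: the argument quantifies only over
representations of per_n itself (uniqueness/indecomposability of an extremiser) and defines no
property of all polynomials of small dc, so it is not a distinguisher/natural proof in the sense of
`NaturalProofAgainstVP`/`SuccinctHittingSetsForVP` — evaded by construction; conceded: this also
means no "largeness" leverage.
- Literature.Barriers.ValiantsHypothesis.PermanentCharTwo: every crux is over ℂ and must use char ≠
2 (no `CharacteristicFreeDcLowerBound`-type argument) — in characteristic 2 dc(per_n) = n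
(`determinantalComplexity_perPoly_le_of_charTwo`) and OptimalUnique is false (per = det has moduli
of optimal expressions); char 0 enters through irreducibility/Hessian facts of per over ℂ and the
ABV17/MR04 base values, so the line is not characteristic-free.
- Literature.Barriers.ValiantsHypothesis.RankMethods: no rank, flattening or sub-additive measure is
used (nor shifted partials: `ShiftedPartialsCannotSeparate` is moot) — N/A by construction; the bet
is structural classification, whose own risk is generic NON-uniqueness of determinantal
representations.
- Negatives index: empty for this summit at filing (`ledger negatives --problem ValiantsHypothesis`:
0).

History (route lifecycle, newest last):
- 2026-08-15T14:22:06Z · BROKEN — OptimalUnique (stmt-ValiantsHypothesis-3735, crux) refuted by Summit.ValiantsHypothesis.Theorems.GrenetRigidityOptimalUnique_refuted @ 7357d070d02c (refuter-rreview-route-Schanuel-StokesCon-003ea356-0)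
- 2026-08-15T14:22:06Z · BROKEN — OptimalUniqueThree (stmt-ValiantsHypothesis-3738, support) refuted by Summit.ValiantsHypothesis.Theorems.GrenetRigidityOptimalUniqueThree_refuted @ 7357d070d02c (refuter-rreview-route-Schanuel-StokesCon-003ea356-0)
- 2026-08-15T16:23:11Z · CLOSED refuted — refuted:stmt-ValiantsHypothesis-3735 (OptimalUnique) by Summit.ValiantsHypothesis.Theorems.GrenetRigidityOptimalUnique_refuted (planner-rbadge-ValiantsHypothesis-GrenetRigidi-0cc5e3a7-g2-0)

sub-problem: ValiantsHypothesis · status: closed(refuted) · opened planner-plancard-ValiantsHypothesis-ValiantsH-bbaa9cce-0 2026-08-15T11:23:27Z · rev 0 · ledger route-ValiantsHypothesis-GrenetRigidity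
GENERATED by the gate from the ledger (D-0016/17). Provers cite these decls: `theorem foo : Summit.ValiantsHypothesis.ValiantsHypothesis.Theses.GrenetRigidity.<Decl> := …` in Summits/ValiantsHypothesis/ValiantsHypothesis/Theorems/<Name>.lean.
-/

namespace Summit.ValiantsHypothesis.ValiantsHypothesis.Theses.GrenetRigidity

open scoped BigOperators Topology Manifold Classical MeasureTheory ProbabilityTheory Matrix InnerProductSpace ComplexConjugate ContinuousMap
open Filter Set Function TopologicalSpace MeasureTheory

attribute [summit_statement] _root_.ValiantsHypothesis

open Literature.PNP

/-- item stmt-ValiantsHypothesis-3733 · target · rank 0 · closed · moot by None · by planner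
why it might fail: X is far stronger than VH: dc(per_n) = 2^{o(n)} (e.g. n^{O(log n)}, compatible with VP ≠ VNP) refutes X while nothing beyond n²/2 ≤ dc(per_n) ≤ 2^n − 1 is known.
sources: Grenet2011, MignonRessayre2004, AlperBogartVelasco2017, LandsbergRessayre2017, Landsberg2017
[target] X — there are c > 1 and n₀ with c^n ≤ dc(per_n) over ℂ for all n ≥ n₀ (output of any
bootstrapped recursion dc(per_{n+1}) ≥ (1+δ)·dc(per_n), in particular of doubling). -/
@[route_item "route-ValiantsHypothesis-GrenetRigidity"]
def DcPerExponential : Prop :=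
  ∃ c : ℝ, 1 < c ∧ ∃ n₀ : ℕ, ∀ n ≥ n₀, c ^ n ≤ (Literature.Computability.AlgebraicComplexity.determinantalComplexity (Literature.Computability.AlgebraicComplexity.perPoly (Fin n) ℂ) : ℝ)

/-- item stmt-ValiantsHypothesis-3734 · crux · rank 2 · closed · moot by None · by planner
why it might fail: Glynn/product-rank-4 depth-3 representations (size (n−1)·2^{n−1}+1: 9 at n=3, 25 at n=4) and bordered matrices [[G,e_p],[e_qᵀ,1]] with a cofactor of Grenet's G vanishing by cancellation lie in the window; ONE indecomposable such matrix at some n ≥ 3 refutes it as stated (repair: n ≥ n₀).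
sources: Glynn2010, IltenTeitler2016, HuttenhainIkenmeyer2016, Grenet2011, Keevash2011
[crux] for every n ≥ 3 and every m with dc(per_n) < m ≤ 2·dc(per_n), every m×m affine determinantal
representation A of per_n over ℂ is DECOMPOSABLE: there are constant P, Q ∈ GL_m(ℂ) and 0 < r < m
such that P·A·Q is block upper triangular with diagonal blocks of sizes r, m − r (so, per_n being
irreducible, A contains a smaller representation plus unimodular junk; iterating, an optimal one).
Card Crux1, sharpened from the (1+ε)-window to the doubling window the bootstrap actually consumes.
[difficulty: XL] -/
@[route_item "route-ValiantsHypothesis-GrenetRigidity"]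
def WindowStability : Prop :=
  ∀ n ≥ 3, ∀ m : ℕ, Literature.Computability.AlgebraicComplexity.determinantalComplexity (Literature.Computability.AlgebraicComplexity.perPoly (Fin n) ℂ) < m → m ≤ 2 * Literature.Computability.AlgebraicComplexity.determinantalComplexity (Literature.Computability.AlgebraicComplexity.perPoly (Fin n) ℂ) → ∀ A : Matrix (Fin m) (Fin m) (MvPolynomial (Fin n × Fin n) ℂ), Literature.Computability.AlgebraicComplexity.IsAffineDetRepr (Literature.Computability.AlgebraicComplexity.perPoly (Fin n) ℂ) A → ∃ (P Q : GL (Fin m) ℂ) (r : ℕ), 0 < r ∧ r < m ∧ ∀ i j : Fin m, r ≤ (i : ℕ) → (j : ℕ) < r → ((P : Matrix (Fin m) (Fin m) ℂ).map MvPolynomial.C * A * (Q : Matrix (Fin m) (Fin m) ℂ).map MvPolynomial.C : Matrix (Fin m) (Fin m) (MvPolynomial (Fin n × Fin n) ℂ)) i j = 0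

/-- item stmt-ValiantsHypothesis-3735 · crux · rank 3 · closed · refuted by Summit.ValiantsHypothesis.Theorems.GrenetRigidityOptimalUnique_refuted @ 7357d070d02c (refuter) · by planner
why it might fail: determinantal representations are generically NOT unique (72 inequivalent size-3 representations of a smooth cubic surface); over ℂ even n = 3 is open (HI16 Prop 9 is binary-only): a positive-dimensional family of inequivalent size-7 representations of per_3 refutes it.
sources: HuttenhainIkenmeyer2016, arXiv:1410.8202, LandsbergRessayre2017, Landsberg2017, AlperBogartVelasco2017
[crux] for every n ≥ 3, any two affine determinantal representations A, B of per_n over ℂ of optimal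
size m = dc(per_n) are equivalent: B = P·A(γ·x)·Q or B = P·A(γ·x)ᵀ·Q with P, Q ∈ GL_m(ℂ) constant
and γ in the realised symmetry group of per_n (monomial row/column substitutions and x ↦ xᵀ,
`permSymmetrySubst`). With dc(per_n) = 2^n − 1 this says: optimal = Grenet. Card "uniqueness of the
optimal representation up to symmetry". [difficulty: XL] -/
@[route_item "route-ValiantsHypothesis-GrenetRigidity"]
def OptimalUnique : Prop :=
  ∀ n ≥ 3, ∀ A B : Matrix (Fin (Literature.Computability.AlgebraicComplexity.determinantalComplexity (Literature.Computability.AlgebraicComplexity.perPoly (Fin n) ℂ))) (Fin (Literature.Computability.AlgebraicComplexity.determinantalComplexity (Literature.Computability.AlgebraicComplexity.perPoly (Fin n) ℂ))) (MvPolynomial (Fin n × Fin n) ℂ), Literature.Computability.AlgebraicComplexity.IsAffineDetRepr (Literature.Computability.AlgebraicComplexity.perPoly (Fin n) ℂ) A → Literature.Computability.AlgebraicComplexity.IsAffineDetRepr (Literature.Computability.AlgebraicComplexity.perPoly (Fin n) ℂ) B → ∃ (P Q : GL (Fin (Literature.Computability.AlgebraicComplexity.determinantalComplexity (Literature.Computability.AlgebraicComplexity.perPoly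 (Fin n) ℂ))) ℂ) (γ : GL (Fin n × Fin n) ℂ), γ ∈ Literature.Computability.AlgebraicComplexity.permSymmetrySubst ℂ n ∧ (B = (P : Matrix _ _ ℂ).map MvPolynomial.C * Literature.Computability.AlgebraicComplexity.Matrix.linSubstEntries γ A * (Q : Matrix _ _ ℂ).map MvPolynomial.C ∨ B = (P : Matrix _ _ ℂ).map MvPolynomial.C * (Literature.Computability.AlgebraicComplexity.Matrix.linSubstEntries γ A).transpose * (Q : Matrix _ _ ℂ).map MvPolynomial.C)

/-- item stmt-ValiantsHypothesis-3736 · crux · rank 4 · closed · moot by None · by planner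
why it might fail: the (n+1)² cores overlap (in Grenet_{n+1} two complementary Grenet_n cores share 2^{n−1} coordinates), so forcing total dimension 2·dc+1 is a non-abelian gluing problem without precedent; and dc(per_4) ≤ 14 with both hypotheses true would falsify it at n = 3.
sources: Nisan1991, Grenet2011, Keevash2011, arXiv:1410.8202, LandsbergRessayre2017
[crux] the bootstrapping (gluing) lemma — WindowStability and OptimalUnique imply dc(per_{n+1}) ≥
2·dc(per_n) + 1 for every n ≥ 3: if dc(per_{n+1}) ≤ 2·dc(per_n), the (n+1)² restrictions x_{ij} = 1,
rest of row i and column j = 0 of an optimal representation of per_{n+1} are representations of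
per_n in the window, each contains an invariant optimal core (a copy of the unique optimal
representation), and compatibility of these cores along per_{n+1} = Σ_j x_{n+1,j} per_n(minor)
forces ≥ 2·dc(per_n) + 1 dimensions. Card Crux2. [deps: WindowStability, OptimalUnique] [difficulty:
L] -/
@[route_item "route-ValiantsHypothesis-GrenetRigidity"]
def LaplaceBootstrap : Prop :=
  WindowStability → OptimalUnique → ∀ n ≥ 3, 2 * Literature.Computability.AlgebraicComplexity.determinantalComplexity (Literature.Computability.AlgebraicComplexity.perPoly (Fin n) ℂ) + 1 ≤ Literature.Computability.AlgebraicComplexity.determinantalComplexity (Literature.Computability.AlgebraicComplexity.perPoly (Fin (n + 1)) ℂ)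

/-- item stmt-ValiantsHypothesis-3737 · crux · rank 5 · closed · moot by None · by planner
why it might fail: only 9 ≤ dc(per_4) ≤ 15 is known (ABV17 Cor 1.4; Grenet) and bdc(per_4) was out of reach of HI16's cluster enumeration; a size-14 affine representation over ℂ (cheap to hunt numerically) refutes it and Conjecture G, though not VH.
sources: AlperBogartVelasco2017, arXiv:1505.02205, HuttenhainIkenmeyer2016, Grenet2011
[crux] dc(per_4) = 15 over ℂ — Grenet's 15×15 representation of the 4×4 permanent is optimal
(Conjecture G at n = 4; the first value the doubling 2·7+1 predicts; certified computation / new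
lower-bound technique). Card Crux3. [difficulty: XL] -/
@[route_item "route-ValiantsHypothesis-GrenetRigidity"]
def DcPerFour : Prop :=
  Literature.Computability.AlgebraicComplexity.determinantalComplexity (Literature.Computability.AlgebraicComplexity.perPoly (Fin 4) ℂ) = 15

/-- item stmt-ValiantsHypothesis-3738 · support · rank 9 · closed · refuted by Summit.ValiantsHypothesis.Theorems.GrenetRigidityOptimalUniqueThree_refuted @ 7357d070d02c (refuter) · by planner
sources: HuttenhainIkenmeyer2016, arXiv:1410.8202, AlperBogartVelasco2017
[support] Step 0 over ℂ (special case n = 3 of OptimalUnique at the known value dc(per_3) = 7): any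
two 7×7 affine determinantal representations of per_3 over ℂ are equivalent under GL_7 × GL_7 ×
G_per × transpose — the complex (continuous-family-excluding) version of HI16 Prop 9; infinitesimal
rigidity of Grenet's 7×7 (490 unknowns, 11440 equations) is its linearisation. [difficulty: L] -/
@[route_item "route-ValiantsHypothesis-GrenetRigidity"]
def OptimalUniqueThree : Prop :=
  ∀ A B : Matrix (Fin 7) (Fin 7) (MvPolynomial (Fin 3 × Fin 3) ℂ), Literature.Computability.AlgebraicComplexity.IsAffineDetRepr (Literature.Computability.AlgebraicComplexity.perPoly (Fin 3) ℂ) A → Literature.Computability.AlgebraicComplexity.IsAffineDetRepr (Literature.Computability.AlgebraicComplexity.perPoly (Fin 3) ℂ) B → ∃ (P Q : GL (Fin 7) ℂ) (γ : GL (Fin 3 × Fin 3) ℂ), γ ∈ Literature.Computability.AlgebraicComplexity.permSymmetrySubst ℂ 3 ∧ (B = (P : Matrix (Fin 7) (Fin 7) ℂ).map MvPolynomial.C * Literature.Computability.AlgebraicComplexity.Matrix.linSubstEntries γ A * (Q : Matrix (Fin 7) (Fin 7) ℂ).map MvPolynomial.C ∨ B = (P : Matrix (Fin 7) (Fin 7)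 ℂ).map MvPolynomial.C * (Literature.Computability.AlgebraicComplexity.Matrix.linSubstEntries γ A).transpose * (Q : Matrix (Fin 7) (Fin 7) ℂ).map MvPolynomial.C)

/-- item stmt-ValiantsHypothesis-3739 · support · rank 9 · closed · moot by None · by planner
sources: MignonRessayre2004, Grenet2011
[support] the layer-1 glue: WindowStability, OptimalUnique and LaplaceBootstrap give doubling for
all n ≥ 3, hence dc(per_n) ≥ 2^{n−3}·(dc(per_3)+1) − 1 ≥ (3/2)^n eventually (dc(per_3) ≥ 1 from
totalDegree ≤ dc, proved in tree), i.e. X. [difficulty: provable-now] -/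
@[route_item "route-ValiantsHypothesis-GrenetRigidity"]
def DoublingGlue : Prop :=
  WindowStability → OptimalUnique → LaplaceBootstrap → DcPerExponential

/-- item stmt-ValiantsHypothesis-3740 · assembly · rank 1 · closed · moot by None · by planner
sources: Burgisser2000, Valiant1979, LandsbergRessayre2017
[assembly] DcPerExponential → ValiantsHypothesis (VP ℂ ≠ VNP ℂ), via VP ⇒ qp-bounded dc and per ∈
VNP, both proved in tree. -/
@[route_item "route-ValiantsHypothesis-GrenetRigidity"]
def Assembly : Prop :=
  DcPerExponential → ValiantsHypothesis

end Summit.ValiantsHypothesis.ValiantsHypothesis.Theses.GrenetRigidity
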